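import Mathlib
import Literature.NumberTheory.LFunctions.Zhang2022.Section10cLamAvgRule
import Literature.NumberTheory.LFunctions.Zhang2022.Section10RangeSecondLine
import HarnessLib

/-!
# Zhang (2022) §10: the "second line" of the range displays, UNCONDITIONAL form on `lamAvg`

Topic `Literature/NumberTheory/LFunctions/Zhang2022` (Landau–Siegel audit tree; verdict-neutral).
Y. Zhang, *Discrete mean estimates and the Landau–Siegel zero*, arXiv:2211.02515v1 (2022)
[Zhang2022LandauSiegel], §10 pp. 57–61 (the displays before (10.12)–(10.15): each range evaluation
closes with "`(κL′(1,χ)²/log²P)Σ_{P^a≤n<P^b}|χ(n)|λ₀ⱼ(n)φ(n)⁻¹F(n) = (κ𝔞/log P)∫_a^b G₀(z)dz + o(α)`")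
— **an unrefereed manuscript under adjudication; this file asserts nothing about its Theorems 1–2
or about Landau–Siegel zeros.** D-0069 campaign, discharge layer L3 (seat sz-d39), theorem-only
TOOL file (no DAG node of its own; consumers: Z22:§10.u056 (ii), u057 (ii), u049 (iii), u050 (ii)).

* `rpow_add_one_le_bigP` — `P^b + 1 ≤ P` for `0 ≤ b < 1`, `(1 − b)𝓛 ≥ 1`;
* `lamAvg_second_line` — the packaging, with NO hypothesis on Z22:§8.u047/u048: it rests on
  sz-d34's `Typed.Sec10C.lamAvg_rule` (Section10cLamAvgRule; built on the tree's weak mean value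
  `Section8cProofs.step8u048_weak`, error `O(𝓛²)` instead of the printed `O(log 𝓛)` — still `o(α)`
  after the prefactor `L′(1,χ)²/log²P ≪ 𝓛⁴·𝓛⁻¹⁸`), on `∫_{P^a}^{P^b}F(t)dt/t = log P·∫_a^b F(P^z)dz`
  (`RangeAverage.integral_div_eq_log_mul_integral_rpow`), `𝔞 = 𝔠_D L′(1,χ)²`
  (`RangeAverage.frakA_eq_frakcD_mul_sq`, tree `Lemma171.frakAC_eq`) and `|L′(1,χ)| ≤ 4e^{9/2}𝓛²`
  (`RangeAverage.norm_deriv_LFunction_one_le_sq`, tree Lemma 3.1). Compare the conditional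
  `RangeAverage.second_line` (Section10RangeSecondLine), which takes the printed §8.u047/u048 as
  hypotheses; this version supersedes it for outright discharges.

## References

* Y. Zhang, arXiv:2211.02515v1 (2022), §10 pp. 57–61; §8 p. 48; §2 (2.6), (2.10), (2.31).
  [cite: Zhang2022LandauSiegel, §10 pp. 57–61]
-/

noncomputable section

open Complex Real ComplexConjugate MeasureTheory
open Literature.NumberTheory.LFunctions.Zhang2022.Skeleton

namespace Literature.NumberTheory.LFunctions.Zhang2022.Typed.Sec10C

section D39SecondLine

/-! ### The unconditional "second line" on `lamAvg` -/

/-- `P^b + 1 ≤ P` once `0 ≤ b < 1` and `(1 − b)𝓛 ≥ 1` (`𝓛 ≥ 1`; `P = e^{𝓛⁹}`). [cite: Zhang2022LandauSiegel, §2 (2.6)] -/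
theorem rpow_add_one_le_bigP {D : ℕ} {b : ℝ} (hb0 : 0 ≤ b) (hb : b < 1) (hℓ1 : 1 ≤ ell D)
    (h1b : 1 ≤ (1 - b) * ell D) : bigP D ^ b + 1 ≤ bigP D := by
  have hℓ0 : 0 < ell D := by linarith
  have hb1 : 0 < 1 - b := by linarith
  have hP : 0 < bigP D := Real.exp_pos _
  have hP1 : 1 < bigP D := by rw [bigP]; exact Real.one_lt_exp_iff.2 (pow_pos hℓ0 9)
  have hℓ9 : ell D ≤ ell D ^ 9 := by
    calc ell D = ell D ^ 1 := (pow_one _).symm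
      _ ≤ ell D ^ 9 := pow_le_pow_right₀ hℓ1 (by norm_num)
  have hexp : Real.log 2 < ell D ^ 9 * (1 - b) := by
    have hl2 := Real.log_two_lt_d9
    nlinarith [mul_le_mul_of_nonneg_right hℓ9 hb1.le]
  have h2 : (2 : ℝ) < bigP D ^ (1 - b) := by
    rw [bigP, ← Real.exp_mul]
    calc (2 : ℝ) = Real.exp (Real.log 2) := (Real.exp_log (by norm_num)).symm
      _ < Real.exp (ell D ^ 9 * (1 - b)) := Real.exp_lt_exp.mpr hexp
  have hhi1 : 1 ≤ bigP D ^ b := Real.one_le_rpow hP1.le hb0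
  have : bigP D ^ b * 2 ≤ bigP D := by
    calc bigP D ^ b * 2 ≤ bigP D ^ b * bigP D ^ (1 - b) := by gcongr
      _ = bigP D := by rw [← Real.rpow_add hP]; norm_num
  linarith

/-- **The "second line" of the §10 range displays, unconditionally.** Fix `κ ∈ ℂ`, a window of
exponents `0 ≤ a ≤ b < 1` and constants `M, M′, C₀ ≥ 0`. For every `ε > 0`, for all large `D`, every
real primitive `χ (mod D)`, every `j`, and every profile `F` differentiable on `[P^a, P^b + 1]` with
`‖F‖ ≤ M`, `‖F′(t)‖ ≤ M′α/t` there, and every `G₀` integrable on `[a, b]` with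
`‖F(P^z) − G₀(z)‖ ≤ C₀𝓛⁻⁸` on `[a, b]`:
`‖(κL′(1,χ)²/log²P)·Σ_{P^a≤n<P^b}|χ(n)|λ₀ⱼ(n)φ(n)⁻¹F(n) − (κ𝔞/log P)∫_a^b G₀(z)dz‖ ≤ εα`
("the results in Section 8" in the derivable form `lamAvg_rule`, then `x = P^z`, then the direct
calculation; total error `O(𝓛⁻¹²)`). [cite: Zhang2022LandauSiegel, §10 pp. 57–61] -/
theorem lamAvg_second_line (c' : ℝ) (κ : ℂ) {a b M M' C₀ : ℝ} (ha : 0 ≤ a) (hab : a ≤ b)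
    (hb : b < 1) (hM : 0 ≤ M) (hM' : 0 ≤ M') (hC₀ : 0 ≤ C₀) :
    ∀ ε : ℝ, 0 < ε → ForAllLarge fun D _ χ => ∀ (j : ℕ) (F G₀ : ℝ → ℂ),
      (∀ t : ℝ, bigP D ^ a ≤ t → t ≤ bigP D ^ b + 1 →
          DifferentiableAt ℝ F t ∧ ‖F t‖ ≤ M ∧ ‖deriv F t‖ ≤ M' * alpha D / t) →
      IntervalIntegrable G₀ volume a b →
      (∀ z ∈ Set.Icc a b, ‖F (bigP D ^ z) - G₀ z‖ ≤ C₀ / ell D ^ 8) →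
      ‖κ * deriv χ.LFunction 1 ^ 2 / (Real.log (bigP D) : ℂ) ^ 2 *
            lamAvg c' χ j (bigP D ^ a) (bigP D ^ b) (fun n => F n) -
          κ * (frakA χ : ℂ) / (Real.log (bigP D) : ℂ) * ∫ z in a..b, G₀ z‖ ≤ ε * alpha D := by
  intro ε hε
  obtain ⟨C, hC0, D₀, hmain⟩ := lamAvg_rule c'
  set cL : ℝ := 4 * Real.exp (9 / 2) with hcL
  set K : ℝ := ‖κ‖ * cL ^ 2 * (C₀ + C * (M + π * M')) with hK
  have hK0 : 0 ≤ K := by positivity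
  refine ⟨max D₀ (max 21 ⌈Real.exp (K / (ε * π) + 1 / (1 - b) + 1)⌉₊),
    fun D _ χ hD hq hp j F G₀ hF hG₀ happrox => ?_⟩
  have hD₀ : D₀ ≤ D := le_trans (le_max_left _ _) hD
  have hD21 : 21 ≤ D := le_trans (le_max_left _ _) (le_trans (le_max_right _ _) hD)
  have hDexp : (⌈Real.exp (K / (ε * π) + 1 / (1 - b) + 1)⌉₊ : ℝ) ≤ D := by
    exact_mod_cast le_trans (le_max_right _ _) (le_trans (le_max_right _ _) hD)
  have hℓ3 : 3 ≤ ell D := (three_lt_log_of_le hD21).le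
  have hℓ0 : 0 < ell D := by linarith
  have hℓ1 : 1 ≤ ell D := by linarith
  have hb1 : 0 < 1 - b := by linarith
  have hℓbig : K / (ε * π) + 1 / (1 - b) + 1 ≤ ell D := by
    rw [ell, Real.le_log_iff_exp_le (by positivity)]
    exact le_trans (Nat.le_ceil _) hDexp
  have hP : 0 < bigP D := Real.exp_pos _
  have hP1 : 1 < bigP D := by rw [bigP]; exact Real.one_lt_exp_iff.2 (pow_pos hℓ0 9)
  have hlogP : Real.log (bigP D) = ell D ^ 9 := by rw [bigP, Real.log_exp]
  have hα : alpha D = π / ell D ^ 9 := by rw [alpha, hlogP]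
  have hα0 : 0 < alpha D := by rw [hα]; positivity
  have hαΛ : alpha D * Real.log (bigP D) = π := by rw [hα, hlogP]; field_simp
  have hχ1 : χ ≠ 1 := Lemma31.ne_one_of_isPrimitive χ (by omega) hp
  -- the window `[P^a, P^b]`
  set lo : ℝ := bigP D ^ a with hlo
  set hi : ℝ := bigP D ^ b with hhi
  have hlo1 : 1 ≤ lo := Real.one_le_rpow hP1.le ha
  have hlohi : lo ≤ hi := Real.rpow_le_rpow_of_exponent_le hP1.le hab
  have h1b : 1 ≤ (1 - b) * ell D := by
    have : 1 / (1 - b) ≤ ell D := by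
      linarith [div_nonneg hK0 (by positivity : (0:ℝ) ≤ ε * π)]
    rwa [div_le_iff₀ hb1, mul_comm] at this
  have hhiP : hi + 1 ≤ bigP D := rpow_add_one_le_bigP (ha.trans hab) hb hℓ1 h1b
  -- (1) the rule
  have hE := hmain D χ hD₀ hq hp j lo hi M (M' * alpha D) F hlo1 hlohi hhiP hM
    (fun t h1 h2 => hF t h1 h2)
  set 𝔠 : ℝ := 6 / π ^ 2 * ∏ q ∈ D.primeFactors, ((q : ℝ) / (q + 1)) with h𝔠
  set I : ℂ := ∫ t in lo..hi, F t / t with hI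
  set N : ℂ := lamAvg c' χ j lo hi (fun n => F n) with hN
  have hEbd : ‖N - (𝔠 : ℂ) * I‖ ≤ C * ell D ^ 2 * (M + π * M') := by
    refine hE.trans (le_of_eq ?_)
    rw [mul_assoc M', hαΛ, mul_comm M' π]
  -- (2) the substitution and the main-value replacement
  have hFc : ContinuousOn F (Set.Icc lo hi) := fun t ht =>
    (hF t ht.1 (by linarith [ht.2])).1.continuousAt.continuousWithinAt
  have hsub : I = Real.log (bigP D) * ∫ z in a..b, F (bigP D ^ z) := by
    rw [hI, hlo, hhi]; exact RangeAverage.integral_div_eq_log_mul_integral_rpow hP1 hab hFc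
  have hFz : IntervalIntegrable (fun z => F (bigP D ^ z)) volume a b := by
    refine (ContinuousOn.comp hFc ((Real.continuous_const_rpow hP.ne').continuousOn)
      ?_).intervalIntegrable_of_Icc hab
    intro z hz
    exact ⟨Real.rpow_le_rpow_of_exponent_le hP1.le hz.1, Real.rpow_le_rpow_of_exponent_le hP1.le hz.2⟩
  set J : ℂ := ∫ z in a..b, G₀ z with hJ
  set R : ℂ := (∫ z in a..b, F (bigP D ^ z)) - J with hR
  have hRbd : ‖R‖ ≤ C₀ / ell D ^ 8 := by
    rw [hR, hJ, ← intervalIntegral.integral_sub hFz hG₀]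
    calc _ ≤ C₀ / ell D ^ 8 * |b - a| :=
          intervalIntegral.norm_integral_le_of_norm_le_const fun z hz => by
            rw [Set.uIoc_of_le hab] at hz; exact happrox z ⟨hz.1.le, hz.2⟩
      _ ≤ C₀ / ell D ^ 8 * 1 := by
          gcongr; rw [abs_le]; constructor <;> linarith
      _ = C₀ / ell D ^ 8 := mul_one _
  -- (3) the algebra: with `𝔞 = 𝔠 L′²`, `X = (κ𝔞/Λ)·R + κL′²(N − 𝔠I)/Λ²`
  have hΛ0 : ((Real.log (bigP D) : ℝ) : ℂ) ≠ 0 := by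
    rw [hlogP]; exact_mod_cast (pow_pos hℓ0 9).ne'
  set L1 : ℂ := deriv χ.LFunction 1 with hL1
  have h𝔞 : (frakA χ : ℂ) = (𝔠 : ℂ) * L1 ^ 2 := by
    rw [h𝔠, hL1]; exact RangeAverage.frakA_eq_frakcD_mul_sq χ hχ1 hq
  have eX : κ * L1 ^ 2 / (Real.log (bigP D) : ℂ) ^ 2 * N -
      κ * (frakA χ : ℂ) / (Real.log (bigP D) : ℂ) * J =
      κ * (frakA χ : ℂ) / (Real.log (bigP D) : ℂ) * R +
        κ * L1 ^ 2 / (Real.log (bigP D) : ℂ) ^ 2 * (N - (𝔠 : ℂ) * I) := by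
    have hIJ : I = ((Real.log (bigP D) : ℝ) : ℂ) * (R + J) := by rw [hsub, hR]; ring
    rw [h𝔞, hIJ]
    field_simp
    ring
  rw [eX]
  -- (4) sizes
  have hL1n : ‖L1‖ ≤ cL * ell D ^ 2 := RangeAverage.norm_deriv_LFunction_one_le_sq χ hℓ3 hp
  have h𝔞n : ‖(frakA χ : ℂ)‖ ≤ (cL * ell D ^ 2) ^ 2 :=
    (RangeAverage.norm_frakA_le_sq χ hχ1 hq).trans (by gcongr)
  have hΛn : ‖((Real.log (bigP D) : ℝ) : ℂ)‖ = ell D ^ 9 := by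
    rw [Complex.norm_real, hlogP, Real.norm_eq_abs, abs_of_pos (pow_pos hℓ0 9)]
  have t1 : ‖κ * (frakA χ : ℂ) / (Real.log (bigP D) : ℂ) * R‖ ≤
      ‖κ‖ * (cL * ell D ^ 2) ^ 2 / ell D ^ 9 * (C₀ / ell D ^ 8) := by
    rw [norm_mul, norm_div, norm_mul, hΛn]
    gcongr
  have t2 : ‖κ * L1 ^ 2 / (Real.log (bigP D) : ℂ) ^ 2 * (N - (𝔠 : ℂ) * I)‖ ≤
      ‖κ‖ * (cL * ell D ^ 2) ^ 2 / (ell D ^ 9) ^ 2 * (C * ell D ^ 2 * (M + π * M')) := by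
    rw [norm_mul, norm_div, norm_mul, norm_pow, norm_pow, hΛn]
    gcongr
  have e1 : ‖κ‖ * (cL * ell D ^ 2) ^ 2 / ell D ^ 9 * (C₀ / ell D ^ 8) =
      ‖κ‖ * cL ^ 2 * C₀ / ell D ^ 13 := by
    field_simp
  have e2 : ‖κ‖ * (cL * ell D ^ 2) ^ 2 / (ell D ^ 9) ^ 2 * (C * ell D ^ 2 * (M + π * M')) =
      ‖κ‖ * cL ^ 2 * (C * (M + π * M')) / ell D ^ 12 := by
    field_simp
  have h1312 : ‖κ‖ * cL ^ 2 * C₀ / ell D ^ 13 ≤ ‖κ‖ * cL ^ 2 * C₀ / ell D ^ 12 := by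
    apply div_le_div_of_nonneg_left (by positivity) (pow_pos hℓ0 12)
    exact pow_le_pow_right₀ hℓ1 (by norm_num)
  have hsum : ‖κ‖ * cL ^ 2 * C₀ / ell D ^ 12 + ‖κ‖ * cL ^ 2 * (C * (M + π * M')) / ell D ^ 12 =
      K / ell D ^ 12 := by
    rw [hK]; ring
  have hfinal : K / ell D ^ 12 ≤ ε * alpha D := by
    rw [hα, div_le_iff₀ (pow_pos hℓ0 12), show ε * (π / ell D ^ 9) * ell D ^ 12 =
      ε * π * ell D ^ 3 by field_simp]
    have h1 : K / (ε * π) ≤ ell D := by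
      linarith [div_nonneg (zero_le_one) hb1.le]
    have h2 : K ≤ ε * π * ell D := by rwa [div_le_iff₀ (by positivity), mul_comm] at h1
    calc K ≤ ε * π * ell D := h2
      _ = ε * π * ell D ^ 1 := by ring
      _ ≤ ε * π * ell D ^ 3 := by gcongr; norm_num
  calc _ ≤ ‖κ * (frakA χ : ℂ) / (Real.log (bigP D) : ℂ) * R‖ +
        ‖κ * L1 ^ 2 / (Real.log (bigP D) : ℂ) ^ 2 * (N - (𝔠 : ℂ) * I)‖ := norm_add_le _ _
    _ ≤ _ := add_le_add t1 t2
    _ = ‖κ‖ * cL ^ 2 * C₀ / ell D ^ 13 + ‖κ‖ * cL ^ 2 * (C * (M + π * M')) / ell D ^ 12 := by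
        rw [e1, e2]
    _ ≤ ‖κ‖ * cL ^ 2 * C₀ / ell D ^ 12 + ‖κ‖ * cL ^ 2 * (C * (M + π * M')) / ell D ^ 12 := by
        gcongr
    _ = K / ell D ^ 12 := hsum
    _ ≤ ε * alpha D := hfinal

end D39SecondLine

end Literature.NumberTheory.LFunctions.Zhang2022.Typed.Sec10C
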